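import Summits.ResolutionOfSingularities.ResolutionOfSingularities.Theses.SectionAscent
import Summits.ResolutionOfSingularities.ResolutionOfSingularities.Theorems.SectionAscentGenericLevel

/-!
# `FibrewiseClosedPoints` — negative lemma III: the crux restates the route target

Support (negative) lemma for crux `stmt-ResolutionOfSingularities-15960`
(`Summit.ResolutionOfSingularities.ResolutionOfSingularities.Theses.SectionAscent.FibrewiseClosedPoints`,
route SectionAscent: `∀ p prime, ∀ d, OneShot p d → Almost p (d+1) → OneShot p (d+1)`), filed by the
refuter's crux attack (2026-08-17). This file declares NO definition, and NO declaration concludes a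
route decl positively.

The route's intermediate predicate `Almost` is inhabited for EVERY affine domain of finite type over
a field by the blowing up presenting the normalisation (tree
`Theorems.exists_ideal_almost_of_normalization`, which also closed the sibling crux `GenericLevel` as
typed; the refuter's parallel proof of the same fact lives in `Negative/OneChartBlowup.lean` +
evidence `AlmostDecoration.lean` on the item). Consequences recorded here:

* `almost_all` — the route's `let`-predicate `Almost p d`, verbatim, holds for all `p`, `d`.
* `not_fibrewiseClosedPoints_iff_not_oneShotAffine` — **the crux fails exactly when the route target
  `OneShotAffine` fails**: as typed, `FibrewiseClosedPoints` IS one-shot strong resolution of affine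
  varieties in every dimension and every characteristic `p > 0` (open from dimension `4`), by the
  route's own induction on `d` (`OneShot p 0` is vacuous); its hypothesis `Almost p (d+1)` hands a
  prover nothing. No degenerate / small-model / finite attack can refute the crux short of refuting
  strong affine resolution itself; conversely no proof of it can be cheaper than the target.

Repair for the planner (not filed here): make the centre exact in `Almost`
(`I ≤ 𝔭.asIdeal ↔ ¬ IsRegularLocalRing A_𝔭`, as in `OneShot`): at a normal singular point the
singular locus has codimension `≥ 2`, so no admissible `I` is invertible there (Hauptidealsatz) and
the finite junk is excluded.
-/

noncomputable section

set_option linter.dupNamespace false -- mandated namespace of this single-conjunct summit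

open AlgebraicGeometry
open Literature.AlgebraicGeometry.Resolution
open Summit.ResolutionOfSingularities.ResolutionOfSingularities.Theses.SectionAscent

namespace Summit.ResolutionOfSingularities.ResolutionOfSingularities.Theorems.FibrewiseClosedPoints.Negative

/-- **`Almost p d` holds outright, for all `p`, `d`** (the route's `let`-predicate verbatim; the
characteristic and the dimension bound are not even used): the normalisation blow-up witness
`Theorems.exists_ideal_almost_of_normalization`. [folklore] -/
theorem almost_all (p d : ℕ) :
    ∀ (K : Type) [Field K] [CharP K p] (A : Type) [CommRing A] [IsDomain A] [Algebra K A]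
      [Algebra.FiniteType K A], ringKrullDim A < (d : WithBot ℕ∞) →
      ∃ I : Ideal A, I ≠ ⊥ ∧
        (∀ 𝔭 : PrimeSpectrum A, ¬ I ≤ 𝔭.asIdeal →
          IsRegularLocalRing (Localization.AtPrime 𝔭.asIdeal)) ∧
        (∀ y : affineBlowup I, IsIntegrallyClosed ((affineBlowup I).presheaf.stalk y)) ∧
        ∀ y : affineBlowup I, (∃ z : affineBlowup I, z ≠ y ∧ y ⤳ z ∧
          (affineBlowup.π I).base z = (affineBlowup.π I).base y) →
            IsRegularLocalRing ((affineBlowup I).presheaf.stalk y) :=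
  fun K _ _ A _ _ _ _ _ =>
    Summit.ResolutionOfSingularities.ResolutionOfSingularities.Theorems.exists_ideal_almost_of_normalization K A

/-- **The crux `FibrewiseClosedPoints` fails exactly when the route target `OneShotAffine` fails**:
as typed, the crux IS one-shot strong resolution of affine varieties in every dimension and every
characteristic `p > 0` (open from dimension `4`), not a statement about closed points of fibres.
(`→`: the target implies the crux outright; `←`: the route's own induction on `d` — base `d = 0`
vacuous, a domain having `ringKrullDim ≥ 0` — fed with `almost_all`.) [folklore] -/
theorem not_fibrewiseClosedPoints_iff_not_oneShotAffine :
    ¬ FibrewiseClosedPoints ↔ ¬ OneShotAffine := by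
  refine ⟨fun h hT => h fun p hp d _ _ => hT p hp (d + 1), fun hT h => hT ?_⟩
  intro p hp d
  induction d with
  | zero =>
      intro K _ _ A _ _ _ _ hdim
      exfalso
      have h0 : (0 : WithBot ℕ∞) ≤ ringKrullDim A := ringKrullDim_nonneg_of_nontrivial
      exact absurd hdim (not_lt.mpr (by simpa using h0))
  | succ d ih => exact h p hp d ih (almost_all p (d + 1))

end Summit.ResolutionOfSingularities.ResolutionOfSingularities.Theorems.FibrewiseClosedPoints.Negative

end
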